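import Summits.AtomisticToContinuum.FouriersLaw.Theorems.VanishingNoiseTransferVanishingNoiseBoundNessGibbsAlmostInvariant
import Summits.AtomisticToContinuum.FouriersLaw.Theorems.VanishingNoiseTransferVanishingNoiseBoundNessLipschitzReduction

/-!
# Stub S2b `stub_nessFlipAsymmetryLipschitz` from temperature-uniform exponential convergence
(line `fekete-usc-one-length`, brick 5: the exact residual of S2b)

`--supports stmt-AtomisticToContinuum-11976` helper file (crux `VanishingNoiseBound`, route
`VanishingNoiseTransfer`).

* `nessFlipAsymmetryLipschitz_of_uniformExpConvergence` — **S2b ⟸ (UH)**: for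
  `pinnedChain ω₂ lam β γ` (all parameters positive), `T > 0`, `N` and the unique weak steady family
  `μ0`, IF the exponential convergence (2.5) towards the invariant probability measures of the
  transition kernels at `(T+δ/2, T-δ/2)` holds with a weight `e^{ϑH}`, `1/(2T) ≤ ϑ < 1/T`, and
  constants `C, c` UNIFORM for `|δ| < δ₀` — hypothesis (UH), the temperature-uniform Harris /
  Lyapunov constants of the flip-free Langevin semigroup near equilibrium, i.e. the core of the
  neighbouring stub S2a — THEN the conclusion of S2b holds: the flip-odd part of
  `μ0 (T+δ/2) (T-δ/2)` is `O(δ)` on continuous `|h| ≤ e^{θ_δ H}`.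

Proof: `nessFlipAsymmetryLipschitz_of_nearGibbs` ((AS) ⟸ (LIP)) and (LIP) from the abstract lever
`abs_integral_le_of_geometric_contraction` (`…NessLipschitzReduction.lean`) with `Q = P_1`,
`μ = μ0_δ` (kernel-invariant by weak uniqueness: it is the CEHR invariant measure), `π = μ_T`,
`V = e^{ϑH} ≥ e^{θ_δ H}`, `F k = P_k g - μ0_δ(g)` (`|F k| ≤ C e^{-ck} V` by (UH), `F (k+1) = P_1 F k`
by Chapman–Kolmogorov), fed with the PROVED almost-invariance (E)
`pinnedChain_gibbsMeasure_almost_invariant`. So after this file S2b needs exactly (UH) and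
nothing about derivatives of the steady state or of the transition densities. No definitions.
-/

noncomputable section

namespace Summit.AtomisticToContinuum.FouriersLaw.Theorems.FixedLengthNoiseContinuity

open MeasureTheory ProbabilityTheory Filter Topology Set
open scoped NNReal ENNReal
open Literature.MathematicalPhysics.KineticTheory.HeatConduction
open Literature.MathematicalPhysics.KineticTheory Literature.Probability.Process OscillatorChain

/-! ## §4 Assembly: stub S2b from temperature-uniform exponential convergence (UH) -/

section Assembly

/-- `∫ f d(μP) = ∫ (∫ f dP(x,·)) dμ(x)` for `f` integrable against `μ.bind P`
(`Kernel.integral_comp` through `Measure.comp_eq_comp_const_apply`). [folklore] -/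
theorem integral_bind_kernel {α : Type*} [MeasurableSpace α] (K : Kernel α α) (μ : Measure α)
    {f : α → ℝ} (hf : Integrable f (μ.bind K)) :
    ∫ y, f y ∂(μ.bind K) = ∫ x, ∫ y, f y ∂(K x) ∂μ := by
  change Integrable f (K ∘ₘ μ) at hf
  rw [Measure.comp_eq_comp_const_apply] at hf ⊢
  rw [Kernel.integral_comp hf, Kernel.const_apply]

variable {ω₂ lam β γ : ℝ}

/-- **Stub S2b `stub_nessFlipAsymmetryLipschitz` from (UH).** For `pinnedChain ω₂ lam β γ` (all
parameters positive), `T > 0`, `N` and the unique weak steady family `μ0`: IF the exponential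
convergence (2.5) towards the invariant probability measures of the transition kernels at
temperatures `(T+δ/2, T-δ/2)` holds with a weight `e^{ϑH}`, `1/(2T) ≤ ϑ < 1/T`, and constants
`C, c` UNIFORM for `|δ| < δ₀` (hypothesis (UH): temperature-uniform Harris/Lyapunov constants of
the flip-free Langevin semigroup near equilibrium — the core of the neighbouring stub S2a), THEN
the flip-odd part of `μ0 (T+δ/2) (T-δ/2)` is `O(δ)` on continuous `|h| ≤ e^{θ_δ H}`,
`θ_δ = 1/(2max(T+δ/2, T-δ/2)) ≤ ϑ`. Proof: `nessFlipAsymmetryLipschitz_of_nearGibbs` ((AS) ⟸ (LIP)),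
and (LIP) from the abstract lever `abs_integral_le_of_geometric_contraction` with `Q = P_1`,
`μ = μ0_δ` (invariant by weak uniqueness), `π = gibbsMeasure N T`, `V = e^{ϑH}`,
`F k = P_k f - μ0_δ(f)` (`|F k| ≤ C e^{-ck} V` by (UH), `F (k+1) = P_1 F k` by Chapman–Kolmogorov)
and the almost-invariance (E) `pinnedChain_gibbsMeasure_almost_invariant`. -/
theorem nessFlipAsymmetryLipschitz_of_uniformExpConvergence (hω : 0 < ω₂) (hl : 0 < lam)
    (hβ : 0 < β) (hγ : 0 < γ) {T : ℝ} (hT : 0 < T) {N : ℕ}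
    (μ0 : ℝ → ℝ → Measure (PhaseSpace N))
    (hμ0 : ∀ T_L T_R : ℝ, 0 < T_L → 0 < T_R →
      (pinnedChain ω₂ lam β γ).IsSteadyState N T_L T_R (μ0 T_L T_R) ∧
        ∀ ν : Measure (PhaseSpace N),
          (pinnedChain ω₂ lam β γ).IsSteadyState N T_L T_R ν → ν = μ0 T_L T_R)
    (hUH : ∃ ϑ δ₀ C c : ℝ, 1 / (2 * T) ≤ ϑ ∧ ϑ < 1 / T ∧ 0 < δ₀ ∧ 0 ≤ C ∧ 0 < c ∧
      ∀ δ : ℝ, |δ| < δ₀ → ∀ μ : Measure (PhaseSpace N), IsProbabilityMeasure μ →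
        (∀ t : ℝ≥0, μ.bind ((pinnedChain ω₂ lam β γ).transitionKernel N (T + δ / 2) (T - δ / 2) t) = μ) →
        ∀ (z : PhaseSpace N) (t : ℝ≥0) (f : PhaseSpace N → ℝ), Continuous f →
          (∀ y, |f y| ≤ Real.exp (ϑ * (pinnedChain ω₂ lam β γ).hamiltonian N y)) →
          |∫ y, f y ∂((pinnedChain ω₂ lam β γ).transitionKernel N (T + δ / 2) (T - δ / 2) t z) -
              ∫ y, f y ∂μ| ≤
            C * Real.exp (ϑ * (pinnedChain ω₂ lam β γ).hamiltonian N z) * Real.exp (-c * t)) :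
    ∃ C δ₁ : ℝ, 0 < δ₁ ∧ ∀ δ : ℝ, δ ≠ 0 → |δ| < δ₁ →
      ∀ (i : Fin N) (h : PhaseSpace N → ℝ), Continuous h →
        (∀ y, |h y| ≤ Real.exp (1 / max (T + δ / 2) (T - δ / 2) / 2 *
          (pinnedChain ω₂ lam β γ).hamiltonian N y)) →
        |∫ y, h (momentumFlip i y) ∂(μ0 (T + δ / 2) (T - δ / 2)) -
            ∫ y, h y ∂(μ0 (T + δ / 2) (T - δ / 2))| ≤ C * |δ| := by
  -- `N = 0`: no site to flip
  rcases Nat.eq_zero_or_pos N with hN0 | hN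
  · subst hN0; exact ⟨0, 1, one_pos, fun δ _ _ i => Fin.elim0 i⟩
  set P := pinnedChain ω₂ lam β γ with hPdef
  obtain ⟨ϑ, δ₀, Ch, c, hϑlo, hϑhi, hδ₀, hCh, hc, hUH⟩ := hUH
  have hϑ0 : 0 < ϑ := lt_of_lt_of_le (by positivity) hϑlo
  have hinvϑ : T < 1 / ϑ := by
    rw [lt_div_iff₀ hϑ0]; rw [lt_div_iff₀ hT] at hϑhi; linarith
  -- (E) at time one with the weight `e^{ϑH}`
  obtain ⟨CE, hCE0, hE⟩ := pinnedChain_gibbsMeasure_almost_invariant hω hl.le hβ.le hγ.le hN hT hϑ0 hϑhi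
    (t := 1) one_pos
  set ρc : ℝ := Real.exp (-c) with hρc
  have hρc0 : 0 ≤ ρc := (Real.exp_pos _).le
  have hρc1 : ρc < 1 := by rw [hρc]; exact Real.exp_lt_one_iff.2 (by linarith)
  refine nessFlipAsymmetryLipschitz_of_nearGibbs hω hl hβ hγ hT μ0 hμ0
    ⟨Ch * CE / (1 - ρc), min δ₀ (min T (1 / ϑ - T)), lt_min hδ₀ (lt_min hT (by linarith)),
      fun δ hδ0 hδ g hg hgb => ?_⟩
  have hδ₀' : |δ| < δ₀ := hδ.trans_le (min_le_left _ _)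
  have hδT : |δ| < T := (hδ.trans_le (min_le_right _ _)).trans_le (min_le_left _ _)
  have hδϑ : |δ| < 1 / ϑ - T := (hδ.trans_le (min_le_right _ _)).trans_le (min_le_right _ _)
  have hTL : 0 < T + δ / 2 := by cases abs_lt.1 hδT; linarith
  have hTR : 0 < T - δ / 2 := by cases abs_lt.1 hδT; linarith
  have hmaxT : T ≤ max (T + δ / 2) (T - δ / 2) := by
    rcases le_or_gt 0 δ with hd | hd
    · exact le_trans (by linarith) (le_max_left _ _)
    · exact le_trans (by linarith) (le_max_right _ _)
  have hmaxlt : max (T + δ / 2) (T - δ / 2) < 1 / ϑ := by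
    cases abs_lt.1 hδϑ
    refine max_lt ?_ ?_ <;> linarith
  have hmax0 : 0 < max (T + δ / 2) (T - δ / 2) := hT.trans_le hmaxT
  have hϑmax : ϑ < 1 / max (T + δ / 2) (T - δ / 2) := by
    rw [lt_div_iff₀ hmax0]; rw [lt_div_iff₀ hϑ0] at hmaxlt; linarith
  -- the weight `V = e^{ϑH}` dominates the class `e^{θ_δ H}`
  set V : PhaseSpace N → ℝ := fun y => Real.exp (ϑ * P.hamiltonian N y) with hVdef
  have hV0 : ∀ y, 0 ≤ V y := fun y => (Real.exp_pos _).le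
  have hθϑ : 1 / max (T + δ / 2) (T - δ / 2) / 2 ≤ ϑ := by
    have h1 : 1 / max (T + δ / 2) (T - δ / 2) ≤ 1 / T := one_div_le_one_div_of_le hT hmaxT
    have h2 : 1 / T / 2 = 1 / (2 * T) := by ring
    linarith [h2 ▸ (div_le_div_of_nonneg_right h1 (by norm_num : (0:ℝ) ≤ 2))]
  have hgV : ∀ y, |g y| ≤ V y := fun y => (hgb y).trans (Real.exp_le_exp.2
    (mul_le_mul_of_nonneg_right hθϑ (pinnedChain_hamiltonian_nonneg hω.le hl.le hβ.le γ N y)))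
  -- the steady state is the invariant probability measure of the kernels (weak uniqueness)
  set μ := μ0 (T + δ / 2) (T - δ / 2) with hμdef
  obtain ⟨-, μs, hμs, hinv, hrest⟩ := pinnedChainSemigroup_ergodic hω hl.le hβ hγ hN hTL hTR
  have hm : 0 < 1 / max (T + δ / 2) (T - δ / 2) := by positivity
  have hss : P.IsSteadyState N (T + δ / 2) (T - δ / 2) μs :=
    pinnedChain_isSteadyState_of_isInvariant hω.le hl.le hβ.le γ N _ hinv (half_pos hm)
      (hrest _ (half_pos hm) (half_lt_self hm)).1
  have hμeq : μs = μ := (hμ0 _ _ hTL hTR).2 μs hss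
  haveI hμprob : IsProbabilityMeasure μ := hμeq ▸ hμs
  set K : ℝ≥0 → Kernel (PhaseSpace N) (PhaseSpace N) := P.transitionKernel N (T + δ / 2) (T - δ / 2) with hKdef
  have hinvK : ∀ t : ℝ≥0, μ.bind (K t) = μ := fun t => by rw [← hμeq]; exact hinv t
  haveI hKprob : ∀ s x, IsProbabilityMeasure (K s x) := fun s x =>
    (pinnedChain_isMarkovKernel_transitionKernel hω hl.le hβ.le hγ.le N (T + δ / 2) (T - δ / 2) s).isProbabilityMeasure x
  have hVm : Measurable V :=
    (Real.continuous_exp.comp (continuous_const.mul (pinnedChain_continuous_hamiltonian ω₂ lam β γ N))).measurable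
  have hVK : ∀ (s : ℝ≥0) (x : PhaseSpace N), Integrable V (K s x) := fun s x =>
    pinnedChain_integrable_transitionKernel_of_abs_le_exp hω hl.le hβ.le hγ.le hN hTL hTR hϑ0 hϑmax s x hVm
      (fun y => by rw [abs_of_nonneg (hV0 y)])
  have hgK : ∀ (s : ℝ≥0) (x : PhaseSpace N), Integrable g (K s x) := fun s x =>
    pinnedChain_integrable_transitionKernel_of_abs_le_exp hω hl.le hβ.le hγ.le hN hTL hTR hϑ0 hϑmax s x
      hg.measurable hgV
  -- the contracting sequence `F k = P_k g - μ(g)`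
  set m : ℝ := ∫ y, g y ∂μ with hmdef
  set F : ℕ → PhaseSpace N → ℝ := fun k z => (∫ y, g y ∂(K (k : ℝ≥0) z)) - m with hFdef
  have hFm : ∀ k, Measurable (F k) := fun k =>
    ((hg.stronglyMeasurable.integral_kernel (κ := K (k : ℝ≥0))).measurable).sub_const m
  have hFb : ∀ k z, |F k z| ≤ Ch * ρc ^ k * V z := by
    intro k z
    have h := hUH δ hδ₀' μ hμprob hinvK z (k : ℝ≥0) g hg hgV
    have e : Real.exp (-c * ((k : ℝ≥0) : ℝ)) = ρc ^ k := by
      rw [hρc, NNReal.coe_natCast, ← Real.exp_nat_mul]; ring_nf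
    rw [e] at h
    calc |F k z| = |(∫ y, g y ∂(K (k : ℝ≥0) z)) - m| := rfl
      _ ≤ Ch * V z * ρc ^ k := h
      _ = Ch * ρc ^ k * V z := by ring
  have hFstep : ∀ k z, F (k + 1) z = ∫ y, F k y ∂(K 1 z) := by
    intro k z
    have hck : ((k + 1 : ℕ) : ℝ≥0) = 1 + (k : ℝ≥0) := by push_cast; ring
    have hK1 : K ((k + 1 : ℕ) : ℝ≥0) z = (K 1 z).bind (K (k : ℝ≥0)) := by
      rw [hck, hKdef, pinnedChain_transitionKernel_add hω hl.le hβ.le hγ.le N (T + δ / 2) (T - δ / 2) 1 (k : ℝ≥0),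
        Kernel.comp_apply]
    have hint : Integrable g ((K 1 z).bind (K (k : ℝ≥0))) := by rw [← hK1]; exact hgK _ z
    have h1 : ∫ y, g y ∂(K ((k + 1 : ℕ) : ℝ≥0) z) = ∫ x, ∫ y, g y ∂(K (k : ℝ≥0) x) ∂(K 1 z) := by
      rw [hK1]; exact integral_bind_kernel _ _ hint
    -- `x ↦ P_k g(x)` is integrable against `P_1(z, ·)` (domination by `e^{C k} V`)
    have hPk : Integrable (fun x => ∫ y, g y ∂(K (k : ℝ≥0) x)) (K 1 z) :=
      ((hVK 1 z).const_mul _).mono' (hg.stronglyMeasurable.integral_kernel (κ := K (k : ℝ≥0))).aestronglyMeasurable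
        (Eventually.of_forall fun x => by
          rw [Real.norm_eq_abs]
          exact pinnedChain_abs_integral_transitionKernel_le hω hl.le hβ.le hγ.le hN hTL hTR hϑ0 hϑmax _ x hgV)
    show (∫ y, g y ∂(K ((k + 1 : ℕ) : ℝ≥0) z)) - m = ∫ y, ((∫ w, g w ∂(K (k : ℝ≥0) y)) - m) ∂(K 1 z)
    rw [integral_sub hPk (integrable_const m), integral_const, probReal_univ, one_smul, h1]
  -- the almost-invariance of the Gibbs measure on measurable `|g'| ≤ V`
  have hEQ : ∀ g' : PhaseSpace N → ℝ, Measurable g' → (∀ x, |g' x| ≤ V x) →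
      |∫ x, (∫ y, g' y ∂(K 1 x)) ∂(P.gibbsMeasure N T) - ∫ x, g' x ∂(P.gibbsMeasure N T)| ≤ CE * |δ| :=
    fun g' hg'm hg'b => hE δ (by linarith) hϑmax g' hg'm hg'b
  haveI : IsProbabilityMeasure (P.gibbsMeasure N T) := pinnedChain_isProbabilityMeasure_gibbsMeasure hω hl.le hβ.le γ N hT
  have hπV : Integrable V (P.gibbsMeasure N T) :=
    pinnedChain_integrable_exp_mul_hamiltonian_gibbsMeasure hω hl.le hβ.le γ N hT hϑhi
  have key := abs_integral_le_of_geometric_contraction (K 1) (P.gibbsMeasure N T) hV0 hπV hCh hρc0 hρc1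
    (ε := CE * |δ|) hEQ F hFm hFb hFstep
  -- `F 0 = g - μ(g)`
  have hF0 : ∀ z, F 0 z = g z - m := fun z => by
    show (∫ y, g y ∂(K ((0 : ℕ) : ℝ≥0) z)) - m = g z - m
    rw [Nat.cast_zero, hKdef, pinnedChain_transitionKernel_zero hω hl.le hβ.le hγ.le N, Kernel.id_apply,
      integral_dirac]
  have hgG : Integrable g (P.gibbsMeasure N T) :=
    hπV.mono' hg.aestronglyMeasurable (Eventually.of_forall fun y => by rw [Real.norm_eq_abs]; exact hgV y)
  have hI0 : ∫ z, F 0 z ∂(P.gibbsMeasure N T) = (∫ z, g z ∂(P.gibbsMeasure N T)) - m := by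
    rw [integral_congr_ae (Eventually.of_forall hF0), integral_sub hgG (integrable_const m), integral_const,
      probReal_univ, one_smul]
  rw [hI0] at key
  rw [abs_sub_comm]
  calc |(∫ z, g z ∂(P.gibbsMeasure N T)) - m| ≤ Ch * (CE * |δ|) / (1 - ρc) := key
    _ = Ch * CE / (1 - ρc) * |δ| := by ring

end Assembly

/-- Registered helper sub-goal `helper_nessFlipAsymmetryOfUniformHarris` of
stmt-AtomisticToContinuum-11976 (= `nessFlipAsymmetryLipschitz_of_uniformExpConvergence`, fully
quantified, notation-free one-line form: stub S2b ⟸ (UH)). -/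
theorem helper_nessFlipAsymmetryOfUniformHarris : ∀ (ω₂ lam β γ : ℝ), 0 < ω₂ → 0 < lam → 0 < β → 0 < γ → ∀ (T : ℝ), 0 < T → ∀ (N : ℕ) (μ0 : ℝ → ℝ → MeasureTheory.Measure (Literature.MathematicalPhysics.KineticTheory.HeatConduction.PhaseSpace N)), (∀ T_L T_R : ℝ, 0 < T_L → 0 < T_R → (Literature.MathematicalPhysics.KineticTheory.HeatConduction.pinnedChain ω₂ lam β γ).IsSteadyState N T_L T_R (μ0 T_L T_R) ∧ ∀ ν : MeasureTheory.Measure (Literature.MathematicalPhysics.KineticTheory.HeatConduction.PhaseSpace N), (Literature.MathematicalPhysics.KineticTheory.HeatConduction.pinnedChain ω₂ lam β γ).IsSteadyState N T_L T_R ν → ν = μ0 T_L T_R) → (∃ ϑ δ₀ C c : ℝ, 1 / (2 * T) ≤ ϑ ∧ ϑ < 1 / T ∧ 0 < δ₀ ∧ 0 ≤ C ∧ 0 < c ∧ ∀ δ : ℝ, |δ| < δ₀ → ∀ μ : MeasureTheory.Measure (Literature.MathematicalPhysics.KineticTheory.HeatConduction.PhaseSpace N), MeasureTheory.IsProbabilityMeasure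 μ → (∀ t : NNReal, μ.bind ((Literature.MathematicalPhysics.KineticTheory.HeatConduction.pinnedChain ω₂ lam β γ).transitionKernel N (T + δ / 2) (T - δ / 2) t) = μ) → ∀ (z : Literature.MathematicalPhysics.KineticTheory.HeatConduction.PhaseSpace N) (t : NNReal) (f : Literature.MathematicalPhysics.KineticTheory.HeatConduction.PhaseSpace N → ℝ), Continuous f → (∀ y, |f y| ≤ Real.exp (ϑ * (Literature.MathematicalPhysics.KineticTheory.HeatConduction.pinnedChain ω₂ lam β γ).hamiltonian N y)) → |MeasureTheory.integral ((Literature.MathematicalPhysics.KineticTheory.HeatConduction.pinnedChain ω₂ lam β γ).transitionKernel N (T + δ / 2) (T - δ / 2) t z) (fun y => f y) - MeasureTheory.integral μ (fun y => f y)| ≤ C * Real.exp (ϑ * (Literature.MathematicalPhysics.KineticTheory.HeatConduction.pinnedChain ω₂ lam β γ).hamiltonian N z) * Real.exp (-c * (t : ℝ))) → ∃ C δ₁ : ℝ, 0 < δ₁ ∧ ∀ δ : ℝ, δ ≠ 0 → |δ| < δ₁ → ∀ (i : Fin N) (h : Literature.MathematicalPhysics.KineticTheory.HeatConduction.PhaseSpace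 N → ℝ), Continuous h → (∀ y, |h y| ≤ Real.exp (1 / max (T + δ / 2) (T - δ / 2) / 2 * (Literature.MathematicalPhysics.KineticTheory.HeatConduction.pinnedChain ω₂ lam β γ).hamiltonian N y)) → |MeasureTheory.integral (μ0 (T + δ / 2) (T - δ / 2)) (fun y => h (Literature.MathematicalPhysics.KineticTheory.HeatConduction.momentumFlip i y)) - MeasureTheory.integral (μ0 (T + δ / 2) (T - δ / 2)) (fun y => h y)| ≤ C * |δ| :=
  fun _ _ _ _ hω hl hβ hγ _ hT _ μ0 hμ0 hUH =>
    nessFlipAsymmetryLipschitz_of_uniformExpConvergence hω hl hβ hγ hT μ0 hμ0 hUH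

end Summit.AtomisticToContinuum.FouriersLaw.Theorems.FixedLengthNoiseContinuity

end
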